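import Summits.CriticalPhenomena.PercolationContinuityZ3.Theorems.PercNearOneGluingAdditiveGluingPairStepWinsDominate
import HarnessLib

/-! # Crux `PercNearOneGluing.AdditiveGluing` (stmt-CriticalPhenomena-4576), line `peel`, stub `stub_toolHijackSplitBHK` —
# tool N2q of the pair step: `Z_{x∉}(s) · Hij ≤ WIN_{x∉}(s) · Zx(s)`

Support file (`--supports stmt-CriticalPhenomena-4576`, registered stub `stub_toolHijackSplitBHK`); no definitions, no named facts.

`μ = prodBernoulli u` on the bond configurations of `Fin n`; relays `A ∋ b, a₀`; the observer `s ∉ A`; a bystander `x ∉ A`,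
`x ≠ s`; `C(s)` the open cluster of `s`, `{C(s) = T}` its fibres; `N₂ = {s ↮ a₀} ∩ {s ↮ x}` (the conditioning set of BHK Thm 1.3
with `X = {a₀, x}`).  The statement: the dead-pocket mass of `s` over the pockets `W ∋ s`, `W ∩ A = ∅`, `x ∉ W` (worst selection,
`Finset.inf'` form) times the hijack mass `μ(s↔b, a₀↮s, x↔a₀)` is at most `μ(s↔b, a₀↮s, s↮x)` times the same pocket mass
re-weighted by `μ(x ↔ a₀ off W)`.
Proof: (i) BHK Thm 1.3 increasing × antitone (`offObs_bhk_mono_anti`) for `φ(T) = 1{b ∈ T}` and `η(T) = μ(x ↔ a₀ off T)`;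
(ii) BHK Thm 1.3 antitone × antitone (`offObs_bhk_anti_anti`) for the pocket functional `ζ` (`pairStep_zeta_antitone`) and `η`;
the four finite sums are identified through the cluster Markov property (`offObs_fibre_inter`) and the elementary structure of
`N₂ ∩ {C(s) = T}`; then `μ(N₂)` is cancelled.
[cite: VandenbergHaggstromKahn2005, Thm. 1.3 (p. 6); KozmaNitzan2024, Lemma 1 (pp. 5–6), §3.2 pp. 12–14]
-/

namespace Summit.CriticalPhenomena.PercolationContinuityZ3.Theorems

open MeasureTheory Set
open Literature.Probability.LatticeModels (prodBernoulli)
open Literature.Probability.Percolation (BondConfig openConn openConnIn openGraph openCluster)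
open scoped BigOperators Classical
noncomputable section

section ToolHijackSplitBHK

variable {n : ℕ}

/-! ### Elementary structure of the fibres `{C(s) = T}` against the events of the statement -/

/-- On `{C(s) = T}`: `s ↔ y` iff `y ∈ T`. [folklore] -/
theorem toolN2q_reach_iff {s : Fin n} {T : Finset (Fin n)} {ω : BondConfig (Fin n)}
    (hω : ω ∈ {ω : BondConfig (Fin n) | openCluster ω s = (T : Set (Fin n))}) (y : Fin n) :
    (openGraph ω).Reachable s y ↔ y ∈ T := by
  rw [← Finset.mem_coe, ← show openCluster ω s = (T : Set (Fin n)) from hω]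
  rfl

/-- `N₂ ∩ {C(s) = T}` is the whole fibre if `a₀, x ∉ T` and empty otherwise. [folklore] -/
theorem toolN2q_N2_inter_fib (s a₀ x : Fin n) (T : Finset (Fin n)) :
    {ω : BondConfig (Fin n) | ∀ y ∈ ({a₀, x} : Set (Fin n)), ¬ (openGraph ω).Reachable s y} ∩
        {ω : BondConfig (Fin n) | openCluster ω s = (T : Set (Fin n))} =
      if (a₀ ∉ T ∧ x ∉ T) then {ω : BondConfig (Fin n) | openCluster ω s = (T : Set (Fin n))} else ∅ := by
  ext ω
  simp only [Set.mem_ite_empty_right, Set.mem_inter_iff]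
  constructor
  · rintro ⟨hN, hω⟩
    simp only [Set.mem_setOf_eq, Set.mem_insert_iff, Set.mem_singleton_iff, forall_eq_or_imp, forall_eq] at hN
    exact ⟨⟨fun h => hN.1 ((toolN2q_reach_iff hω a₀).2 h), fun h => hN.2 ((toolN2q_reach_iff hω x).2 h)⟩, hω⟩
  · rintro ⟨⟨ha, hx⟩, hω⟩
    refine ⟨?_, hω⟩
    simp only [Set.mem_setOf_eq, Set.mem_insert_iff, Set.mem_singleton_iff, forall_eq_or_imp, forall_eq]
    exact ⟨fun h => ha ((toolN2q_reach_iff hω a₀).1 h), fun h => hx ((toolN2q_reach_iff hω x).1 h)⟩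

/-- `{C(s) = T} ∩ {s↔b, a₀↮s, s↮x}` is the whole fibre if `b ∈ T`, `a₀, x ∉ T` and empty otherwise. [folklore] -/
theorem toolN2q_fib_inter_win (s b a₀ x : Fin n) (T : Finset (Fin n)) :
    {ω : BondConfig (Fin n) | openCluster ω s = (T : Set (Fin n))} ∩
        (openConn s b ∩ (openConn a₀ s)ᶜ ∩ (openConn s x)ᶜ) =
      if (b ∈ T ∧ a₀ ∉ T ∧ x ∉ T) then {ω : BondConfig (Fin n) | openCluster ω s = (T : Set (Fin n))} else ∅ := by
  ext ω
  simp only [Set.mem_ite_empty_right, Set.mem_inter_iff, Set.mem_compl_iff]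
  constructor
  · rintro ⟨hω, ⟨hsb, has⟩, hsx⟩
    refine ⟨⟨(toolN2q_reach_iff hω b).1 hsb, fun ha => has ?_, fun hx => hsx ?_⟩, hω⟩
    · exact (((toolN2q_reach_iff hω a₀).2 ha).symm : (openGraph ω).Reachable a₀ s)
    · exact (((toolN2q_reach_iff hω x).2 hx) : (openGraph ω).Reachable s x)
  · rintro ⟨⟨hb, ha, hx⟩, hω⟩
    refine ⟨hω, ⟨?_, fun h => ha ?_⟩, fun h => hx ((toolN2q_reach_iff hω x).1 h)⟩
    · exact (((toolN2q_reach_iff hω b).2 hb) : (openGraph ω).Reachable s b)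
    · exact (toolN2q_reach_iff hω a₀).1 (SimpleGraph.Reachable.symm h)

/-- `{C(s) = T} ∩ {s↔b, a₀↮s, x↔a₀}` is `{C(s) = T} ∩ {x ↔ a₀}` if `b ∈ T`, `a₀, x ∉ T` and empty otherwise (a path from
`x ∈ C(s)` to `a₀` would put `a₀` in `C(s)`). [folklore] -/
theorem toolN2q_fib_inter_hij (s b a₀ x : Fin n) (T : Finset (Fin n)) :
    {ω : BondConfig (Fin n) | openCluster ω s = (T : Set (Fin n))} ∩
        (openConn s b ∩ (openConn a₀ s)ᶜ ∩ openConn x a₀) =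
      if (b ∈ T ∧ a₀ ∉ T ∧ x ∉ T) then
        {ω : BondConfig (Fin n) | openCluster ω s = (T : Set (Fin n))} ∩ openConn x a₀ else ∅ := by
  ext ω
  simp only [Set.mem_ite_empty_right, Set.mem_inter_iff, Set.mem_compl_iff]
  constructor
  · rintro ⟨hω, ⟨hsb, has⟩, hxa⟩
    have ha : a₀ ∉ T := fun ha =>
      has (((toolN2q_reach_iff hω a₀).2 ha).symm : (openGraph ω).Reachable a₀ s)
    refine ⟨⟨(toolN2q_reach_iff hω b).1 hsb, ha, fun hx => ha ?_⟩, hω, hxa⟩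
    exact (toolN2q_reach_iff hω a₀).1 (((toolN2q_reach_iff hω x).2 hx).trans hxa)
  · rintro ⟨⟨hb, ha, -⟩, hω, hxa⟩
    refine ⟨hω, ⟨?_, fun h => ha ?_⟩, hxa⟩
    · exact (((toolN2q_reach_iff hω b).2 hb) : (openGraph ω).Reachable s b)
    · exact (toolN2q_reach_iff hω a₀).1 (SimpleGraph.Reachable.symm h)

/-- The measure of an `if … then S else ∅`. [folklore] -/
theorem toolN2q_real_ite (u : Sym2 (Fin n) → unitInterval) (P : Prop) [Decidable P] (S : Set (BondConfig (Fin n))) :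
    (prodBernoulli u).real (if P then S else ∅) = if P then (prodBernoulli u).real S else 0 := by
  split_ifs <;> simp

/-- `μ(N₂ ∩ {C(s) = T}) = 1{a₀, x ∉ T} μ(C(s) = T)`. [folklore] -/
theorem toolN2q_real_N2_inter_fib (u : Sym2 (Fin n) → unitInterval) (s a₀ x : Fin n) (T : Finset (Fin n)) :
    (prodBernoulli u).real
        ({ω : BondConfig (Fin n) | ∀ y ∈ ({a₀, x} : Set (Fin n)), ¬ (openGraph ω).Reachable s y} ∩
          {ω : BondConfig (Fin n) | openCluster ω s = (T : Set (Fin n))}) =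
      if (a₀ ∉ T ∧ x ∉ T) then (prodBernoulli u).real {ω : BondConfig (Fin n) | openCluster ω s = (T : Set (Fin n))}
        else 0 := by
  rw [toolN2q_N2_inter_fib, toolN2q_real_ite]

/-- A fibre `{C(s) = T}` with `s ∉ T` is null (it is empty). [folklore] -/
theorem toolN2q_real_fib_eq_zero (u : Sym2 (Fin n) → unitInterval) (s : Fin n) (T : Finset (Fin n)) (hs : s ∉ T) :
    (prodBernoulli u).real {ω : BondConfig (Fin n) | openCluster ω s = (T : Set (Fin n))} = 0 := by
  rw [offObs_fib_eq_empty s T hs, measureReal_empty]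

/-- **Pocket decoupling** (cluster Markov property): for `x ∉ T`,
`μ(C(s) = T) · μ(x ↔ a₀ off T) = μ({C(s) = T} ∩ {x ↔ a₀})`. [cite: KozmaNitzan2024, §3.2 (proof of Thm 5, p. 14)] -/
theorem toolN2q_fib_mul_eta (u : Sym2 (Fin n) → unitInterval) (s x a₀ : Fin n) (T : Finset (Fin n)) (hx : x ∉ T) :
    (prodBernoulli u).real {ω : BondConfig (Fin n) | openCluster ω s = (T : Set (Fin n))} *
        (prodBernoulli u).real (openConnIn ((T : Set (Fin n))ᶜ) x a₀) =
      (prodBernoulli u).real ({ω : BondConfig (Fin n) | openCluster ω s = (T : Set (Fin n))} ∩ openConn x a₀) := by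
  by_cases hs : s ∈ T
  · rw [goodPM_cluster_inter_openConn s x a₀ T hx,
      offObs_fibre_inter u s T hs _ (offObs_determinedBy_openConnIn_compl T x a₀)]
  · rw [offObs_fib_eq_empty s T hs, Set.empty_inter, measureReal_empty, zero_mul]

/-! ### The four finite sums of BHK Thm 1.3 with `X = {a₀, x}` -/

/-- `Σ_T 1{b ∈ T} μ(N₂ ∩ {C(s) = T}) = μ(s↔b, a₀↮s, s↮x)`. [folklore] -/
theorem toolN2q_sum_phi (u : Sym2 (Fin n) → unitInterval) (s b a₀ x : Fin n) :
    ∑ T : Finset (Fin n), (if b ∈ T then (1 : ℝ) else 0) *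
        (prodBernoulli u).real
          ({ω : BondConfig (Fin n) | ∀ y ∈ ({a₀, x} : Set (Fin n)), ¬ (openGraph ω).Reachable s y} ∩
            {ω : BondConfig (Fin n) | openCluster ω s = (T : Set (Fin n))}) =
      (prodBernoulli u).real (openConn s b ∩ (openConn a₀ s)ᶜ ∩ (openConn s x)ᶜ) := by
  rw [← offObs_sum_fib_inter u s (openConn s b ∩ (openConn a₀ s)ᶜ ∩ (openConn s x)ᶜ)]
  refine Finset.sum_congr rfl fun T _ => ?_
  rw [toolN2q_real_N2_inter_fib, toolN2q_fib_inter_win, toolN2q_real_ite]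
  by_cases hbT : b ∈ T
  · by_cases h2 : (a₀ ∉ T ∧ x ∉ T)
    · rw [if_pos hbT, if_pos h2, if_pos (show b ∈ T ∧ a₀ ∉ T ∧ x ∉ T from ⟨hbT, h2⟩), one_mul]
    · rw [if_neg h2, if_neg (show ¬(b ∈ T ∧ a₀ ∉ T ∧ x ∉ T) from fun h => h2 h.2), mul_zero]
  · rw [if_neg hbT, if_neg (show ¬(b ∈ T ∧ a₀ ∉ T ∧ x ∉ T) from fun h => hbT h.1), zero_mul]

/-- `Σ_T 1{b ∈ T} μ(x ↔ a₀ off T) μ(N₂ ∩ {C(s) = T}) = μ(s↔b, a₀↮s, x↔a₀)` (pocket decoupling). [folklore] -/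
theorem toolN2q_sum_phi_eta (u : Sym2 (Fin n) → unitInterval) (s b a₀ x : Fin n) :
    ∑ T : Finset (Fin n), ((if b ∈ T then (1 : ℝ) else 0) *
          (prodBernoulli u).real (openConnIn ((T : Set (Fin n))ᶜ) x a₀)) *
        (prodBernoulli u).real
          ({ω : BondConfig (Fin n) | ∀ y ∈ ({a₀, x} : Set (Fin n)), ¬ (openGraph ω).Reachable s y} ∩
            {ω : BondConfig (Fin n) | openCluster ω s = (T : Set (Fin n))}) =
      (prodBernoulli u).real (openConn s b ∩ (openConn a₀ s)ᶜ ∩ openConn x a₀) := by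
  rw [← offObs_sum_fib_inter u s (openConn s b ∩ (openConn a₀ s)ᶜ ∩ openConn x a₀)]
  refine Finset.sum_congr rfl fun T _ => ?_
  rw [toolN2q_real_N2_inter_fib, toolN2q_fib_inter_hij, toolN2q_real_ite]
  by_cases hbT : b ∈ T
  · by_cases h2 : (a₀ ∉ T ∧ x ∉ T)
    · rw [if_pos hbT, if_pos h2, if_pos (show b ∈ T ∧ a₀ ∉ T ∧ x ∉ T from ⟨hbT, h2⟩), one_mul, mul_comm]
      exact toolN2q_fib_mul_eta u s x a₀ T h2.2
    · rw [if_neg h2, if_neg (show ¬(b ∈ T ∧ a₀ ∉ T ∧ x ∉ T) from fun h => h2 h.2), mul_zero]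
  · rw [if_neg hbT, if_neg (show ¬(b ∈ T ∧ a₀ ∉ T ∧ x ∉ T) from fun h => hbT h.1), zero_mul, zero_mul]

/-- `Σ_T ζ(T) μ(N₂ ∩ {C(s) = T}) = Z_{x∉}(s)`: the `ζ`-sum is the dead-pocket mass over the pockets not containing `x`.
[folklore] -/
theorem toolN2q_sum_zeta (u : Sym2 (Fin n) → unitInterval) (A : Finset (Fin n)) (b a₀ s x : Fin n) (hb : b ∈ A)
    (ha₀ : a₀ ∈ A) :
    ∑ T : Finset (Fin n), (if Disjoint T A then
          A.inf' ⟨b, hb⟩ (fun a => (prodBernoulli u).real (openConnIn ((T : Set (Fin n)))ᶜ a b)) else 0) *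
        (prodBernoulli u).real
          ({ω : BondConfig (Fin n) | ∀ y ∈ ({a₀, x} : Set (Fin n)), ¬ (openGraph ω).Reachable s y} ∩
            {ω : BondConfig (Fin n) | openCluster ω s = (T : Set (Fin n))}) =
      ∑ W ∈ (Finset.univ : Finset (Finset (Fin n))).filter (fun W => (s ∈ W ∧ Disjoint W A) ∧ x ∉ W),
        (prodBernoulli u).real {ω : BondConfig (Fin n) | openCluster ω s = (W : Set (Fin n))}
          * A.inf' ⟨b, hb⟩ (fun a => (prodBernoulli u).real (openConnIn ((W : Set (Fin n))ᶜ) a b)) := by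
  rw [Finset.sum_filter]
  refine Finset.sum_congr rfl fun T _ => ?_
  rw [toolN2q_real_N2_inter_fib]
  by_cases hd : Disjoint T A
  · have haT : a₀ ∉ T := fun h => Finset.disjoint_left.1 hd h ha₀
    by_cases hsT : s ∈ T
    · by_cases hxT : x ∈ T
      · rw [if_pos hd, if_neg (show ¬(a₀ ∉ T ∧ x ∉ T) from fun h => h.2 hxT),
          if_neg (show ¬((s ∈ T ∧ Disjoint T A) ∧ x ∉ T) from fun h => h.2 hxT), mul_zero]
      · rw [if_pos hd, if_pos (show a₀ ∉ T ∧ x ∉ T from ⟨haT, hxT⟩),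
          if_pos (show (s ∈ T ∧ Disjoint T A) ∧ x ∉ T from ⟨⟨hsT, hd⟩, hxT⟩), mul_comm]
    · rw [toolN2q_real_fib_eq_zero u s T hsT,
        if_neg (show ¬((s ∈ T ∧ Disjoint T A) ∧ x ∉ T) from fun h => hsT h.1.1)]
      split_ifs <;> simp
  · rw [if_neg hd, zero_mul, if_neg (show ¬((s ∈ T ∧ Disjoint T A) ∧ x ∉ T) from fun h => hd h.1.2)]

/-- `Σ_T ζ(T) η(T) μ(N₂ ∩ {C(s) = T}) = Zx(s)`: the `ζη`-sum is the dead-pocket mass over the pockets not containing `x`,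
re-weighted by `μ(x ↔ a₀ off W)`. [folklore] -/
theorem toolN2q_sum_zeta_eta (u : Sym2 (Fin n) → unitInterval) (A : Finset (Fin n)) (b a₀ s x : Fin n) (hb : b ∈ A)
    (ha₀ : a₀ ∈ A) :
    ∑ T : Finset (Fin n), ((if Disjoint T A then
          A.inf' ⟨b, hb⟩ (fun a => (prodBernoulli u).real (openConnIn ((T : Set (Fin n)))ᶜ a b)) else 0) *
          (prodBernoulli u).real (openConnIn ((T : Set (Fin n))ᶜ) x a₀)) *
        (prodBernoulli u).real
          ({ω : BondConfig (Fin n) | ∀ y ∈ ({a₀, x} : Set (Fin n)), ¬ (openGraph ω).Reachable s y} ∩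
            {ω : BondConfig (Fin n) | openCluster ω s = (T : Set (Fin n))}) =
      ∑ W ∈ (Finset.univ : Finset (Finset (Fin n))).filter (fun W => (s ∈ W ∧ Disjoint W A) ∧ x ∉ W),
        (prodBernoulli u).real {ω : BondConfig (Fin n) | openCluster ω s = (W : Set (Fin n))}
          * A.inf' ⟨b, hb⟩ (fun a => (prodBernoulli u).real (openConnIn ((W : Set (Fin n))ᶜ) a b))
          * (prodBernoulli u).real (openConnIn ((W : Set (Fin n))ᶜ) x a₀) := by
  rw [Finset.sum_filter]
  refine Finset.sum_congr rfl fun T _ => ?_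
  rw [toolN2q_real_N2_inter_fib]
  by_cases hd : Disjoint T A
  · have haT : a₀ ∉ T := fun h => Finset.disjoint_left.1 hd h ha₀
    by_cases hsT : s ∈ T
    · by_cases hxT : x ∈ T
      · rw [if_pos hd, if_neg (show ¬(a₀ ∉ T ∧ x ∉ T) from fun h => h.2 hxT),
          if_neg (show ¬((s ∈ T ∧ Disjoint T A) ∧ x ∉ T) from fun h => h.2 hxT), mul_zero]
      · rw [if_pos hd, if_pos (show a₀ ∉ T ∧ x ∉ T from ⟨haT, hxT⟩),
          if_pos (show (s ∈ T ∧ Disjoint T A) ∧ x ∉ T from ⟨⟨hsT, hd⟩, hxT⟩)]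
        ring
    · rw [toolN2q_real_fib_eq_zero u s T hsT,
        if_neg (show ¬((s ∈ T ∧ Disjoint T A) ∧ x ∉ T) from fun h => hsT h.1.1)]
      split_ifs <;> simp
  · rw [if_neg hd, zero_mul, zero_mul, if_neg (show ¬((s ∈ T ∧ Disjoint T A) ∧ x ∉ T) from fun h => hd h.1.2)]

/-- The real-number endgame: from `d·H ≤ W·P`, `Z·P ≤ d·Z'`, `H ≤ d` and signs, `Z·H ≤ W·Z'` (cancel `d`, or `H = 0`).
[folklore] -/
theorem toolN2q_algebra {d H W P Z Z' : ℝ} (hi : d * H ≤ W * P) (hii : Z * P ≤ d * Z') (hd : 0 ≤ d) (hHd : H ≤ d)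
    (hH : 0 ≤ H) (hW : 0 ≤ W) (hZ : 0 ≤ Z) (hZ' : 0 ≤ Z') : Z * H ≤ W * Z' := by
  by_cases hd0 : d = 0
  · have hH0 : H = 0 := le_antisymm (hd0 ▸ hHd) hH
    rw [hH0, mul_zero]
    exact mul_nonneg hW hZ'
  · have hdpos : 0 < d := lt_of_le_of_ne hd (Ne.symm hd0)
    have h1 : d * (Z * H) ≤ Z * (W * P) := by
      have := mul_le_mul_of_nonneg_left hi hZ
      linarith
    have h2 : Z * (W * P) ≤ d * (W * Z') := by
      have := mul_le_mul_of_nonneg_left hii hW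
      linarith
    exact le_of_mul_le_mul_left (h1.trans h2) hdpos

end ToolHijackSplitBHK

/-- **TOOL N2q (`stub_toolHijackSplitBHK`, registered; `--supports stmt-CriticalPhenomena-4576`):
`Z_{x∉}(s) · Hij ≤ WIN_{x∉}(s) · Zx(s)`** — the dead-pocket mass of `s` over the pockets `W ∋ s`, `W ∩ A = ∅`, `x ∉ W`
(worst selection) times the hijack mass `μ(s↔b, a₀↮s, x↔a₀)` is at most `μ(s↔b, a₀↮s, s↮x)` times the pocket mass
re-weighted by `μ(x ↔ a₀ off W)`.  BHK 2006 Thm 1.3 for the cluster of `s` given `s ↮ {a₀, x}` twice ((i) `1{b ∈ C(s)}`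
increasing vs `η(T) = μ(x ↔ a₀ off T)` antitone; (ii) the pocket functional `ζ` and `η`, both antitone), the four sums
identified by pocket decoupling, then `μ(s ↮ {a₀, x})` cancelled.
[cite: VandenbergHaggstromKahn2005, Thm. 1.3 (p. 6); KozmaNitzan2024, Lemma 1 (pp. 5–6), §3.2 pp. 12–14] -/
theorem stub_toolHijackSplitBHK :
    ∀ (n : ℕ) (u : Sym2 (Fin n) → unitInterval) (A : Finset (Fin n)) (b a₀ s x : Fin n) (hb : b ∈ A),
      a₀ ∈ A → s ∉ A → x ∉ A → s ≠ x →
      (∑ W ∈ (Finset.univ : Finset (Finset (Fin n))).filter (fun W => (s ∈ W ∧ Disjoint W A) ∧ x ∉ W),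
              (prodBernoulli u).real {ω : BondConfig (Fin n) | openCluster ω s = (W : Set (Fin n))}
                * A.inf' ⟨b, hb⟩ (fun a => (prodBernoulli u).real (openConnIn ((W : Set (Fin n))ᶜ) a b)))
        * (prodBernoulli u).real (openConn s b ∩ (openConn a₀ s)ᶜ ∩ openConn x a₀)
      ≤ (prodBernoulli u).real (openConn s b ∩ (openConn a₀ s)ᶜ ∩ (openConn s x)ᶜ)
        * (∑ W ∈ (Finset.univ : Finset (Finset (Fin n))).filter (fun W => (s ∈ W ∧ Disjoint W A) ∧ x ∉ W),
              (prodBernoulli u).real {ω : BondConfig (Fin n) | openCluster ω s = (W : Set (Fin n))}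
                * A.inf' ⟨b, hb⟩ (fun a => (prodBernoulli u).real (openConnIn ((W : Set (Fin n))ᶜ) a b))
                * (prodBernoulli u).real (openConnIn ((W : Set (Fin n))ᶜ) x a₀)) := by
  intro n u A b a₀ s x hb ha₀ hsA _hxA hsx
  have hsX : s ∉ ({a₀, x} : Set (Fin n)) := by
    simp only [Set.mem_insert_iff, Set.mem_singleton_iff, not_or]
    exact ⟨fun h => hsA (h ▸ ha₀), hsx⟩
  have hφ : Monotone (fun T : Finset (Fin n) => if b ∈ T then (1 : ℝ) else 0) := by
    intro T T' h
    by_cases hbT : b ∈ T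
    · simp only [hbT, h hbT, if_true, le_refl]
    · simp only [hbT, if_false]
      split_ifs <;> norm_num
  have hη : Antitone (fun T : Finset (Fin n) => (prodBernoulli u).real (openConnIn ((T : Set (Fin n))ᶜ) x a₀)) := by
    intro T T' h
    exact measureReal_mono (goodStep24_openConnIn_mono (Set.compl_subset_compl.2 (Finset.coe_subset.2 h)) x a₀)
      (measure_ne_top _ _)
  have hi := offObs_bhk_mono_anti u s ({a₀, x} : Set (Fin n)) hsX
    (fun T : Finset (Fin n) => if b ∈ T then (1 : ℝ) else 0)
    (fun T : Finset (Fin n) => (prodBernoulli u).real (openConnIn ((T : Set (Fin n))ᶜ) x a₀)) hφ hη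
  have hii := offObs_bhk_anti_anti u s ({a₀, x} : Set (Fin n)) hsX _ _ (pairStep_zeta_antitone u A b hb) hη
  beta_reduce at hi hii
  rw [toolN2q_sum_phi_eta u s b a₀ x, toolN2q_sum_phi u s b a₀ x] at hi
  rw [toolN2q_sum_zeta u A b a₀ s x hb ha₀, toolN2q_sum_zeta_eta u A b a₀ s x hb ha₀] at hii
  -- signs and `Hij ≤ μ(N₂)`
  have hsub : (openConn s b ∩ (openConn a₀ s)ᶜ ∩ openConn x a₀ : Set (BondConfig (Fin n))) ⊆
      {ω : BondConfig (Fin n) | ∀ y ∈ ({a₀, x} : Set (Fin n)), ¬ (openGraph ω).Reachable s y} := by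
    rintro ω ⟨⟨-, has⟩, hxa⟩
    simp only [Set.mem_setOf_eq, Set.mem_insert_iff, Set.mem_singleton_iff, forall_eq_or_imp, forall_eq]
    simp only [Set.mem_compl_iff] at has
    refine ⟨fun h => has ?_, fun h => has ?_⟩
    · exact (h.symm : (openGraph ω).Reachable a₀ s)
    · exact ((h.trans hxa).symm : (openGraph ω).Reachable a₀ s)
  have hnn : ∀ U : Finset (Fin n), 0 ≤ A.inf' ⟨b, hb⟩
      (fun a => (prodBernoulli u).real (openConnIn ((U : Set (Fin n)))ᶜ a b)) :=
    fun U => Finset.le_inf' _ _ fun a _ => measureReal_nonneg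
  refine toolN2q_algebra hi hii measureReal_nonneg (measureReal_mono hsub (measure_ne_top _ _)) measureReal_nonneg
    measureReal_nonneg ?_ ?_
  · exact Finset.sum_nonneg fun W _ => mul_nonneg measureReal_nonneg (hnn W)
  · exact Finset.sum_nonneg fun W _ => mul_nonneg (mul_nonneg measureReal_nonneg (hnn W)) measureReal_nonneg

end

end Summit.CriticalPhenomena.PercolationContinuityZ3.Theorems
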